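import Literature.NumberTheory.Sieve.IwaniecAlmostPrimesHolds
import Literature.NumberTheory.Sieve.LiouvillePolynomialValues
import HarnessLib

/-!
# `n² + 1` is `n`-smooth with positive lower density — Teräväinen 2024, Prop. 2.11 for `P = X² + 1`, `q = 1` (PROVED)

Second sibling proof file (theorems only; the first, `LiouvillePolynomialValuesProofs.lean`, treats
Corollary 2.1) of `LiouvillePolynomialValues.lean`, whose named fact
`Literature.NumberTheory.Sieve.teravainen2024_prop_2_11_quadratic` is J. Teräväinen, *On the
Liouville function at polynomial arguments*, Amer. J. Math. 146 (2024) = arXiv:2010.07924,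
Proposition 2.11, quadratic clause: every quadratic `P ∈ ℤ[x]` with positive leading coefficient
has property S (Definition 2.9: `P(n)` is `n`-smooth for lower density `≥ η₀/q` along every
progression `n ≡ b (mod q)`).  The printed proof (§7, "Proof sketch of Proposition 2.11") is a
pointer: the irreducible quadratic case "follows with minor modifications" from Harman's
half-dimensional-sieve theorem that `n² + 1` is `n^{4/5+ε}`-smooth with positive lower density
[cite: Harman2008] (improving [cite: Dartyge1996]), Harman's remark that `x² − D` is similar, and
the reduction `4aP(n) = (2an + b)² − Δ`.

## What is PROVED here

`sq_add_one_smooth_pos_density`: **there are `c > 0` and `X₀` with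
`#{1 ≤ n ≤ X : every prime factor of n² + 1 is ≤ n} ≥ cX` for all `X ≥ X₀`** — the instance
`P = X² + 1`, `q = b = 1` of Proposition 2.11 (restated in the exact inner form of
`HasPropertyS (X² + 1)` at `q = b = 1` as `teravainen2024_prop_2_11_sq_add_one_trivial_progression`,
and in the form `p ≤ 2X` used by `Summit.Parity.BatemanHorn.Theses.ParityCode.SmoothValuesDensity`
as `sq_add_one_smooth_twoX_pos_density`).  This is the exponent-`1` case of the Dartyge–Harman
theorems; the constant `c = 1/61341696` is not optimised.

## The argument (not the paper's; a self-contained route through results PROVED in the tree)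

Exponent `1` is the boundary of the trivial range: by the Chebyshev–Markov mass computation the
primes `> n x^δ` and `≤ n log x` dividing `n² + 1` are harmless, but the window in between needs
equidistribution of the roots of `ν² + 1 ≡ 0 (mod d)` for moduli `d` slightly BEYOND `x`.  The
tree contains exactly such an input, proved from Weil's bound for Kloosterman sums: Iwaniec's
level of distribution `x^{16/15}` in bilinear form for `n² + 1`
(`Iwaniec1978.proposition1_corollary_holds`, [cite: IwaniecInventiones1978, Corollary p. 176]).
We use it for a LOWER bound directly:

* (`forall_prime_dvd_le_of_pair_dvd`) if primes `p₁, p₂ ≤ n` with `p₁p₂ > 3n` divide `n² + 1`, then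
  `n² + 1 = p₁ p₂ r` with `r < n`, so `n² + 1` is `n`-smooth;
* (`sum_sum_card_window_ge`) for `y < n ≤ 2y`, `p₁ ∈ A ⊂ (y^{1/32}, y^{1/20}]`,
  `p₂ ∈ B ⊂ (6y^{31/32}, y^{39/40}]` (so `p₁p₂ > 6y ≥ 3n`, `p₂ < n`), the number of incidences
  `p₁p₂ ∣ n² + 1` is `y (∑_B ρ(p₂)/p₂)(∑_A ρ(p₁)/p₁) + ∑∑ (r(2y; p₁p₂) − r(y; p₁p₂))`, and Iwaniec's
  Corollary with the prime-indicator coefficients `b = 1_A` (primes are squarefree, `|b| ≤ 1`),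
  the outer sum restricted to the primes of `B`, bounds both remainder sums by `C y^{1−1/200}`
  (`abs_sum_sum_rem_le`; exponents: `1/20 < 1/15 − 1/200`, `39/40 < 1 − 4/200`);
* (`sum_rho_div_range_ge`) Mertens' theorem for `ρ` with bounded error
  (`Iwaniec1978.RhoMertensStrong_holds`: `∑_{p ≤ t} ρ(p) log p/p = log t + O(1)`, from
  `L(1, χ₄) ≠ 0` à la [cite: Apostol1976, §7.3 eq. (4)]) gives `∑_{a < p ≤ b} ρ(p)/p ≥
  (log b − log a − 2C)/log b`, hence `∑_A ≥ 3/16` and `∑_B ≥ 1/312` for large `y`;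
* (`card_pairs_dvd_le`, `sum_sum_card_window_le`) each `n ≤ 2y` carries at most
  `(log(4y² + 1)/log y^{1/32})² ≤ 96²` incidences, all of them making `n² + 1` `n`-smooth.

Hence `#{n ≤ 2y smooth} ≥ (y/1664 − y/3328)/9216` for `y ≥ y₀`, i.e. density `≥ 1/61341696`.

## What is NOT proved (status of the named fact)

`teravainen2024_prop_2_11_quadratic` itself — all quadratics, ALL progressions `b (mod q)` with the
uniform constant `η₀/q` — stays a named fact.  The substitution `n = b + qt` turns the progression
case into the same statement for the quadratic `P(b + qX)`, and the argument above goes through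
verbatim GIVEN a level of distribution `x^{1+γ}` for the roots of a general irreducible quadratic
(for `P = X² + 1` in a progression: for `(qX + b)² + 1`, discriminant `−4q²`).  That input —
Iwaniec's Proposition 1 beyond `n² + 1`, i.e. Lemke Oliver's Lemmas 3, 4, 8 (Hooley's method with
classes of binary quadratic forms of discriminant `disc P`, Pell units for positive discriminant,
Weil's bound) [cite: LemkeOliverActaArith2012, §2] — is in the tree only for `n² + 1` over the full
interval (`IwaniecAlmostPrimesProp1.lean` and its eight supporting files), cf. the closing note of
`IwaniecAlmostPrimesQuadratic.lean`.  The reducible quadratics (products of two linear factors)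
are elementary (`π(y) = o(y)`) and not treated here either.

## References

* J. Teräväinen, Amer. J. Math. 146 (2024) 1115–1167, Prop. 2.11, Def. 2.9, §7. [Teravainen2024]
* H. Iwaniec, Invent. Math. 47 (1978) 171–188, Corollary p. 176. [IwaniecInventiones1978]
* C. Dartyge, Acta Math. Hungar. 72 (1996) 1–34; G. Harman, Arch. Math. 90 (2008) 239–245.
  [Dartyge1996, Harman2008]
* R. J. Lemke Oliver, Acta Arith. 151 (2012) 241–261, §2. [LemkeOliverActaArith2012]
-/

open Finset Real Filter
open scoped Classical

noncomputable section

namespace Literature.NumberTheory.Sieve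

open Iwaniec1978

/-! ### Step 1. The bilinear remainder with prime-indicator coefficients -/

/-- With the indicator coefficients `b = 1_A` of a set `A` of integers `1 ≤ n < N` all coprime to
`m`, Iwaniec's bilinear form `B(x; m, N)` is `∑_{n ∈ A} r(𝒜; mn)`. [folklore] -/
theorem bilinearB_indicator_eq (x N : ℝ) (A : Finset ℕ) (m : ℕ)
    (hA : ∀ n ∈ A, 1 ≤ n ∧ (n : ℝ) < N ∧ n.Coprime m) :
    bilinearB x (fun n => if n ∈ A then (1 : ℝ) else 0) m N = ∑ n ∈ A, rem x (m * n) := by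
  unfold bilinearB
  have hsub : A ⊆ (Finset.Ico 1 ⌈N⌉₊).filter (fun n : ℕ => n.Coprime m) := by
    intro n hn
    obtain ⟨h1, h2, h3⟩ := hA n hn
    rw [Finset.mem_filter, Finset.mem_Ico]
    refine ⟨⟨h1, ?_⟩, h3⟩
    have : (n : ℝ) < ⌈N⌉₊ := h2.trans_le (Nat.le_ceil N)
    exact_mod_cast this
  rw [← Finset.sum_subset hsub]
  · refine Finset.sum_congr rfl fun n hn => ?_
    simp only [if_pos hn, one_mul]
  · intro n _ hn
    simp only [if_neg hn, zero_mul]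

/-- **Iwaniec's level of distribution `x^{16/15}` applied to prime-indicator coefficients.**
For `ε > 0` there is `C` such that for `x ≥ 2`, every set `A` of primes `< x^{1/15 − ε}` and every
set `B ⊆ [1, x^{1−4ε})` of moduli coprime to all members of `A`,
`|∑_{m ∈ B} ∑_{n ∈ A} r(𝒜; mn)| ≤ C x^{1−ε}` (`r(𝒜; d) = #{n ≤ x : d ∣ n² + 1} − ρ(d) x/d`).
[cite: IwaniecInventiones1978, Corollary p. 176] -/
theorem abs_sum_sum_rem_le {ε : ℝ} (hε : 0 < ε) :
    ∃ C : ℝ, 0 ≤ C ∧ ∀ (x : ℝ) (A B : Finset ℕ), 2 ≤ x →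
      (∀ n ∈ A, n.Prime ∧ (n : ℝ) < x ^ (1 / 15 - ε)) →
      (∀ m ∈ B, 1 ≤ m ∧ (m : ℝ) < x ^ (1 - 4 * ε)) →
      (∀ n ∈ A, ∀ m ∈ B, n.Coprime m) →
        |∑ m ∈ B, ∑ n ∈ A, rem x (m * n)| ≤ C * x ^ (1 - ε) := by
  obtain ⟨C, hC⟩ := proposition1_corollary_holds ε hε
  refine ⟨max C 0, le_max_right _ _, fun x A B hx hA hB hAB => ?_⟩
  set b : ℕ → ℝ := fun n => if n ∈ A then (1 : ℝ) else 0 with hb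
  have hb1 : ∀ n, |b n| ≤ 1 := fun n => by
    simp only [hb]; split_ifs <;> simp
  have hb2 : ∀ n, ¬ Squarefree n → b n = 0 := fun n hn => by
    simp only [hb]
    rw [if_neg]
    intro hnA
    exact hn (hA n hnA).1.prime.squarefree
  have hmain := hC x b hx hb1 hb2
  have hBsub : B ⊆ Finset.Ico 1 ⌈x ^ (1 - 4 * ε)⌉₊ := by
    intro m hm
    obtain ⟨h1, h2⟩ := hB m hm
    rw [Finset.mem_Ico]
    refine ⟨h1, ?_⟩
    have : (m : ℝ) < ⌈x ^ (1 - 4 * ε)⌉₊ := h2.trans_le (Nat.le_ceil _)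
    exact_mod_cast this
  have heq : ∀ m ∈ B, bilinearB x b m (x ^ (1 / 15 - ε)) = ∑ n ∈ A, rem x (m * n) := by
    intro m hm
    refine bilinearB_indicator_eq x _ A m fun n hn => ⟨(hA n hn).1.one_lt.le, (hA n hn).2, ?_⟩
    exact hAB n hn m hm
  calc |∑ m ∈ B, ∑ n ∈ A, rem x (m * n)|
      ≤ ∑ m ∈ B, |∑ n ∈ A, rem x (m * n)| := Finset.abs_sum_le_sum_abs _ _
    _ = ∑ m ∈ B, |bilinearB x b m (x ^ (1 / 15 - ε))| :=
        Finset.sum_congr rfl fun m hm => by rw [heq m hm]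
    _ ≤ ∑ m ∈ Finset.Ico 1 ⌈x ^ (1 - 4 * ε)⌉₊, |bilinearB x b m (x ^ (1 / 15 - ε))| :=
        Finset.sum_le_sum_of_subset_of_nonneg hBsub fun _ _ _ => abs_nonneg _
    _ ≤ C * x ^ (1 - ε) := hmain
    _ ≤ max C 0 * x ^ (1 - ε) := by
        gcongr
        exact le_max_left _ _


/-! ### Step 2. Counting in the window `(y, 2y]` -/

/-- `#{y < n ≤ 2y : d ∣ n² + 1} = |𝒜_d|(2y) − |𝒜_d|(y)`. [folklore] -/
theorem card_window_dvd_eq {y : ℝ} (hy : 0 ≤ y) (d : ℕ) :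
    ((((Finset.Ioc ⌊y⌋₊ ⌊2 * y⌋₊).filter fun n : ℕ => d ∣ n ^ 2 + 1).card : ℕ) : ℝ) =
      (congrCount (2 * y) d : ℝ) - congrCount y d := by
  have hle : ⌊y⌋₊ ≤ ⌊2 * y⌋₊ := Nat.floor_mono (by linarith)
  have hIcc : ∀ n : ℕ, Finset.Icc 1 n = Finset.Ioc 0 n := fun n => by
    ext k; simp only [Finset.mem_Icc, Finset.mem_Ioc]; omega
  unfold congrCount
  rw [hIcc, hIcc, ← Finset.Ioc_union_Ioc_eq_Ioc (Nat.zero_le _) hle, Finset.filter_union,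
    Finset.card_union_of_disjoint
      (Finset.disjoint_filter_filter (Finset.Ioc_disjoint_Ioc_of_le le_rfl))]
  push_cast
  ring

/-- The window count split into Iwaniec's main term and remainders:
`#{y < n ≤ 2y : d ∣ n² + 1} = ρ(d) y/d + r(2y; d) − r(y; d)`. [folklore] -/
theorem card_window_dvd_eq_main_add_rem {y : ℝ} (hy : 0 ≤ y) (d : ℕ) :
    ((((Finset.Ioc ⌊y⌋₊ ⌊2 * y⌋₊).filter fun n : ℕ => d ∣ n ^ 2 + 1).card : ℕ) : ℝ) =
      (rho d : ℝ) * y / d + rem (2 * y) d - rem y d := by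
  rw [card_window_dvd_eq hy]
  unfold rem
  ring

/-- Exchange of summation: summing the window counts over pairs of moduli `(m, n)` counts, for
each `k` in the window, the pairs with `mn ∣ k² + 1`. [folklore] -/
theorem sum_sum_card_filter_dvd_eq (A B I : Finset ℕ) :
    ∑ m ∈ B, ∑ n ∈ A, ((I.filter fun k : ℕ => m * n ∣ k ^ 2 + 1).card : ℝ) =
      ∑ k ∈ I, (((B ×ˢ A).filter fun q : ℕ × ℕ => q.1 * q.2 ∣ k ^ 2 + 1).card : ℝ) := by
  simp only [Finset.card_filter, Nat.cast_sum, Nat.cast_ite, Nat.cast_one, Nat.cast_zero]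
  calc ∑ m ∈ B, ∑ n ∈ A, ∑ k ∈ I, (if m * n ∣ k ^ 2 + 1 then (1 : ℝ) else 0)
      = ∑ m ∈ B, ∑ k ∈ I, ∑ n ∈ A, (if m * n ∣ k ^ 2 + 1 then (1 : ℝ) else 0) :=
        Finset.sum_congr rfl fun _ _ => Finset.sum_comm
    _ = ∑ k ∈ I, ∑ m ∈ B, ∑ n ∈ A, (if m * n ∣ k ^ 2 + 1 then (1 : ℝ) else 0) := Finset.sum_comm
    _ = ∑ k ∈ I, ∑ q ∈ B ×ˢ A, (if q.1 * q.2 ∣ k ^ 2 + 1 then (1 : ℝ) else 0) :=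
        Finset.sum_congr rfl fun k _ => by rw [Finset.sum_product]

/-- **The smoothness mechanism.**  If two primes `m, n ≤ k` with `mn > 3k` satisfy
`mn ∣ k² + 1` (`k ≥ 1`), then every prime factor of `k² + 1` is `≤ k`: the cofactor
`(k² + 1)/(mn)` is `< (k² + 1)/(3k) ≤ k`. [folklore] -/
theorem forall_prime_dvd_le_of_pair_dvd {k m n : ℕ} (hk : 1 ≤ k) (hm : m.Prime) (hn : n.Prime)
    (hdvd : m * n ∣ k ^ 2 + 1) (hmk : m ≤ k) (hnk : n ≤ k) (hbig : 3 * k < m * n) :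
    ∀ p : ℕ, p.Prime → p ∣ k ^ 2 + 1 → p ≤ k := by
  obtain ⟨r, hr⟩ := hdvd
  have hr_le : r ≤ k := by
    by_contra h
    push Not at h
    have h1 : k + 1 ≤ r := h
    have h2 : m * n * (k + 1) ≤ m * n * r := Nat.mul_le_mul_left _ h1
    nlinarith
  intro p hp hpd
  rw [hr] at hpd
  rcases (Nat.Prime.dvd_mul hp).mp hpd with h | h
  · rcases (Nat.Prime.dvd_mul hp).mp h with h' | h'
    · rw [(Nat.prime_dvd_prime_iff_eq hp hm).mp h']; exact hmk
    · rw [(Nat.prime_dvd_prime_iff_eq hp hn).mp h']; exact hnk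
  · have hr0 : 0 < r := by
      rcases Nat.eq_zero_or_pos r with h0 | h0
      · rw [h0, mul_zero] at hr; omega
      · exact h0
    exact (Nat.le_of_dvd hr0 h).trans hr_le

/-- **Multiplicity.**  If all members of `A` and `B` are primes `> z > 1` and `k² + 1 ≤ M`, the
number of pairs `(m, n) ∈ B × A` with `mn ∣ k² + 1` is at most `(log M / log z)²`: both
coordinates are prime factors of `k² + 1` exceeding `z`, and there are at most `log M/log z` of
those. [folklore] -/
theorem card_pairs_dvd_le {A B : Finset ℕ} {z M : ℝ} (hz : 1 < z) {k : ℕ}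
    (hM : ((k ^ 2 + 1 : ℕ) : ℝ) ≤ M)
    (hA : ∀ n ∈ A, n.Prime ∧ z < n) (hB : ∀ m ∈ B, m.Prime ∧ z < m) :
    (((B ×ˢ A).filter fun q : ℕ × ℕ => q.1 * q.2 ∣ k ^ 2 + 1).card : ℝ) ≤
      (Real.log M / Real.log z) ^ 2 := by
  set F : Finset ℕ := (k ^ 2 + 1).primeFactors.filter fun p : ℕ => z < p with hF
  have hk0 : k ^ 2 + 1 ≠ 0 := by positivity
  -- the pairs inject into F × F
  have hsub : ((B ×ˢ A).filter fun q : ℕ × ℕ => q.1 * q.2 ∣ k ^ 2 + 1) ⊆ F ×ˢ F := by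
    intro q hq
    rw [Finset.mem_filter, Finset.mem_product] at hq
    obtain ⟨⟨hqB, hqA⟩, hq⟩ := hq
    rw [Finset.mem_product, hF, Finset.mem_filter, Finset.mem_filter, Nat.mem_primeFactors,
      Nat.mem_primeFactors]
    exact ⟨⟨⟨(hB _ hqB).1, (dvd_mul_right q.1 q.2).trans hq, hk0⟩, (hB _ hqB).2⟩,
      ⟨⟨(hA _ hqA).1, (dvd_mul_left q.2 q.1).trans hq, hk0⟩, (hA _ hqA).2⟩⟩
  -- #F ≤ log M / log z
  have hzF : ∀ p ∈ F, z < (p : ℝ) := fun p hp => by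
    rw [hF, Finset.mem_filter] at hp; exact hp.2
  have hprod_dvd : ∏ p ∈ F, p ∣ k ^ 2 + 1 :=
    (Finset.prod_dvd_prod_of_subset _ _ _ (Finset.filter_subset _ _)).trans
      (Nat.prod_primeFactors_dvd _)
  have hprod_le : ((∏ p ∈ F, p : ℕ) : ℝ) ≤ M :=
    le_trans (by exact_mod_cast Nat.le_of_dvd (by positivity) hprod_dvd) hM
  have hpow_le : z ^ F.card ≤ ((∏ p ∈ F, p : ℕ) : ℝ) := by
    push_cast
    rw [← Finset.prod_const]
    exact Finset.prod_le_prod (fun _ _ => by linarith) fun p hp => (hzF p hp).le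
  have hz0 : 0 < z := by linarith
  have hlogz : 0 < Real.log z := Real.log_pos hz
  have hcardF : (F.card : ℝ) ≤ Real.log M / Real.log z := by
    rw [le_div_iff₀ hlogz]
    have h1 : Real.log (z ^ F.card) ≤ Real.log M := by
      have hzpow : 0 < z ^ F.card := by positivity
      exact Real.log_le_log hzpow (hpow_le.trans hprod_le)
    rwa [Real.log_pow] at h1
  calc (((B ×ˢ A).filter fun q : ℕ × ℕ => q.1 * q.2 ∣ k ^ 2 + 1).card : ℝ)
      ≤ ((F ×ˢ F).card : ℝ) := by exact_mod_cast Finset.card_le_card hsub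
    _ = (F.card : ℝ) * F.card := by rw [Finset.card_product]; push_cast; ring
    _ ≤ (Real.log M / Real.log z) * (Real.log M / Real.log z) :=
        mul_le_mul hcardF hcardF (Nat.cast_nonneg _) (le_trans (Nat.cast_nonneg _) hcardF)
    _ = (Real.log M / Real.log z) ^ 2 := by ring


/-! ### Step 3. Mertens' theorem for `ρ` on a range of primes, and the main term -/

/-- Filtering the primes `p ≤ b` by `¬ (a < p)` leaves exactly the primes `p ≤ a`
(`0 ≤ a ≤ b`; `p ≤ ⌊a⌋₊ ↔ p ≤ a`). [folklore] -/
theorem primesLE_filter_not_lt {a b : ℝ} (ha : 0 ≤ a) (hab : a ≤ b) :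
    (Nat.primesLE ⌊b⌋₊).filter (fun p : ℕ => ¬ a < (p : ℝ)) = Nat.primesLE ⌊a⌋₊ := by
  ext p
  simp only [Finset.mem_filter, Nat.mem_primesLE, not_lt]
  constructor
  · rintro ⟨⟨-, hp⟩, hpa⟩
    exact ⟨Nat.le_floor hpa, hp⟩
  · rintro ⟨hpa, hp⟩
    have hpa' : (p : ℝ) ≤ a := (Nat.le_floor_iff ha).mp hpa
    exact ⟨⟨Nat.le_floor (hpa'.trans hab), hp⟩, hpa'⟩

/-- **Mertens I for `ρ` on a range**: if `|∑_{p ≤ t} ρ(p) log p/p − log t| ≤ C` (`t ≥ 1`), then for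
`1 ≤ a ≤ b`, `b > 1`: `∑_{a < p ≤ b} ρ(p)/p ≥ (log b − log a − 2C)/log b`.
[folklore] -/
theorem sum_rho_div_range_ge {C : ℝ} (hC : ∀ t : ℝ, 1 ≤ t → |rhoLogSum t - Real.log t| ≤ C)
    {a b : ℝ} (ha : 1 ≤ a) (hab : a ≤ b) (hb : 1 < b) :
    (Real.log b - Real.log a - 2 * C) / Real.log b ≤
      ∑ p ∈ (Nat.primesLE ⌊b⌋₊).filter (fun p : ℕ => a < (p : ℝ)), (rho p : ℝ) / p := by
  set S := (Nat.primesLE ⌊b⌋₊).filter (fun p : ℕ => a < (p : ℝ)) with hS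
  have hlogb : 0 < Real.log b := Real.log_pos hb
  -- the weighted sum over the range is a difference of two values of `rhoLogSum`
  have hsplit : ∑ p ∈ S, (rho p : ℝ) * Real.log p / p = rhoLogSum b - rhoLogSum a := by
    have h := Finset.sum_filter_add_sum_filter_not (Nat.primesLE ⌊b⌋₊)
      (fun p : ℕ => a < (p : ℝ)) (fun p : ℕ => (rho p : ℝ) * Real.log p / p)
    rw [primesLE_filter_not_lt (by linarith) hab] at h
    unfold rhoLogSum
    rw [← hS] at h
    linarith
  have hlow : Real.log b - Real.log a - 2 * C ≤ ∑ p ∈ S, (rho p : ℝ) * Real.log p / p := by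
    rw [hsplit]
    have h1 := hC b (by linarith)
    have h2 := hC a ha
    rw [abs_le] at h1 h2
    linarith [h1.1, h2.2]
  -- compare with `log b · ∑ ρ(p)/p`
  have hup : ∑ p ∈ S, (rho p : ℝ) * Real.log p / p ≤ Real.log b * ∑ p ∈ S, (rho p : ℝ) / p := by
    rw [Finset.mul_sum]
    refine Finset.sum_le_sum fun p hp => ?_
    rw [hS, Finset.mem_filter, Nat.mem_primesLE] at hp
    have hp0 : (0 : ℝ) < p := by exact_mod_cast hp.1.2.pos
    have hpb : (p : ℝ) ≤ b := by
      have : (p : ℝ) ≤ ⌊b⌋₊ := by exact_mod_cast hp.1.1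
      exact this.trans (Nat.floor_le (by linarith))
    have hlogp : Real.log p ≤ Real.log b := Real.log_le_log hp0 hpb
    have hρ : (0 : ℝ) ≤ (rho p : ℝ) / p := by positivity
    calc (rho p : ℝ) * Real.log p / p = Real.log p * ((rho p : ℝ) / p) := by ring
      _ ≤ Real.log b * ((rho p : ℝ) / p) := mul_le_mul_of_nonneg_right hlogp hρ
  rw [div_le_iff₀ hlogb]
  linarith

/-- The main term factorises: `∑_{m ∈ B} ∑_{n ∈ A} ρ(mn) y/(mn) = y (∑_B ρ(m)/m)(∑_A ρ(n)/n)` when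
every member of `A` is coprime to every member of `B` (multiplicativity of `ρ`).
[cite: IwaniecInventiones1978, §4 p. 176 ("ρ is multiplicative")] -/
theorem sum_sum_rho_main_eq (y : ℝ) {A B : Finset ℕ} (hA0 : ∀ n ∈ A, n ≠ 0) (hB0 : ∀ m ∈ B, m ≠ 0)
    (hAB : ∀ n ∈ A, ∀ m ∈ B, n.Coprime m) :
    ∑ m ∈ B, ∑ n ∈ A, (rho (m * n) : ℝ) * y / ((m * n : ℕ) : ℝ) =
      y * (∑ m ∈ B, (rho m : ℝ) / m) * (∑ n ∈ A, (rho n : ℝ) / n) := by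
  rw [mul_assoc, Finset.sum_mul_sum, Finset.mul_sum]
  refine Finset.sum_congr rfl fun m hm => ?_
  rw [Finset.mul_sum]
  refine Finset.sum_congr rfl fun n hn => ?_
  rw [rho_mul_of_coprime (hB0 m hm) (hA0 n hn) (hAB n hn m hm).symm]
  have hm0 : (m : ℝ) ≠ 0 := by exact_mod_cast hB0 m hm
  have hn0 : (n : ℝ) ≠ 0 := by exact_mod_cast hA0 n hn
  push_cast
  field_simp

/-- **Lower bound for the pair count in the window** (level of distribution): for `0 < ε < 1/16`
there is `C ≥ 0` such that for `y ≥ 2`, any set `A` of primes `< y^{1/15−ε}` and any set `B` of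
moduli `1 ≤ m < y^{1−4ε}` coprime to the members of `A`,
`∑_{m ∈ B} ∑_{n ∈ A} #{y < k ≤ 2y : mn ∣ k² + 1} ≥ y (∑_B ρ(m)/m)(∑_A ρ(n)/n) − C((2y)^{1−ε} + y^{1−ε})`.
[cite: IwaniecInventiones1978, Corollary p. 176] -/
theorem sum_sum_card_window_ge {ε : ℝ} (hε : 0 < ε) (hε' : ε < 1 / 16) :
    ∃ C : ℝ, 0 ≤ C ∧ ∀ (y : ℝ) (A B : Finset ℕ), 2 ≤ y →
      (∀ n ∈ A, n.Prime ∧ (n : ℝ) < y ^ (1 / 15 - ε)) →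
      (∀ m ∈ B, 1 ≤ m ∧ (m : ℝ) < y ^ (1 - 4 * ε)) →
      (∀ n ∈ A, ∀ m ∈ B, n.Coprime m) →
        y * (∑ m ∈ B, (rho m : ℝ) / m) * (∑ n ∈ A, (rho n : ℝ) / n) -
            C * ((2 * y) ^ (1 - ε) + y ^ (1 - ε)) ≤
          ∑ m ∈ B, ∑ n ∈ A,
            ((((Finset.Ioc ⌊y⌋₊ ⌊2 * y⌋₊).filter fun k : ℕ => m * n ∣ k ^ 2 + 1).card : ℕ) : ℝ) := by
  obtain ⟨C, hC0, hC⟩ := abs_sum_sum_rem_le hε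
  refine ⟨C, hC0, fun y A B hy hA hB hAB => ?_⟩
  have hy0 : 0 ≤ y := by linarith
  have hexp1 : 0 ≤ 1 / 15 - ε := by linarith
  have hexp2 : 0 ≤ 1 - 4 * ε := by linarith
  have hy2 : y ≤ 2 * y := by linarith
  -- hypotheses at `x = 2y`
  have hA2 : ∀ n ∈ A, n.Prime ∧ (n : ℝ) < (2 * y) ^ (1 / 15 - ε) := fun n hn =>
    ⟨(hA n hn).1, (hA n hn).2.trans_le (Real.rpow_le_rpow hy0 hy2 hexp1)⟩
  have hB2 : ∀ m ∈ B, 1 ≤ m ∧ (m : ℝ) < (2 * y) ^ (1 - 4 * ε) := fun m hm =>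
    ⟨(hB m hm).1, (hB m hm).2.trans_le (Real.rpow_le_rpow hy0 hy2 hexp2)⟩
  have hR2 := hC (2 * y) A B (by linarith) hA2 hB2 hAB
  have hR1 := hC y A B hy hA hB hAB
  have hA0 : ∀ n ∈ A, n ≠ 0 := fun n hn => (hA n hn).1.ne_zero
  have hB0 : ∀ m ∈ B, m ≠ 0 := fun m hm => by have := (hB m hm).1; omega
  have hdec : ∑ m ∈ B, ∑ n ∈ A,
      ((((Finset.Ioc ⌊y⌋₊ ⌊2 * y⌋₊).filter fun k : ℕ => m * n ∣ k ^ 2 + 1).card : ℕ) : ℝ) =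
      y * (∑ m ∈ B, (rho m : ℝ) / m) * (∑ n ∈ A, (rho n : ℝ) / n) +
        ∑ m ∈ B, ∑ n ∈ A, rem (2 * y) (m * n) - ∑ m ∈ B, ∑ n ∈ A, rem y (m * n) := by
    rw [← sum_sum_rho_main_eq y hA0 hB0 hAB, ← Finset.sum_add_distrib, ← Finset.sum_sub_distrib]
    refine Finset.sum_congr rfl fun m _ => ?_
    rw [← Finset.sum_add_distrib, ← Finset.sum_sub_distrib]
    refine Finset.sum_congr rfl fun n _ => ?_
    rw [card_window_dvd_eq_main_add_rem hy0]
  rw [hdec]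
  rw [abs_le] at hR1 hR2
  nlinarith [hR1.1, hR1.2, hR2.1, hR2.2]


/-! ### Step 4. The pair count is dominated by the number of smooth values -/

/-- **Upper bound for the pair count by the smooth count.**  If `A, B` consist of primes in
`(z, y]` (`z > 1`, `y ≥ 1`) with `mn > 6y` for all `(m, n) ∈ B × A`, then
`∑_{m ∈ B} ∑_{n ∈ A} #{y < k ≤ 2y : mn ∣ k² + 1} ≤ (log M/log z)² · #{1 ≤ k ≤ 2y : k² + 1 is k-smooth}`
for any `M ≥ 4y² + 1`: a `k` in the window admitting such a pair is `k`-smooth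
(`forall_prime_dvd_le_of_pair_dvd`) and admits at most `(log M/log z)²` pairs (`card_pairs_dvd_le`).
[folklore] -/
theorem sum_sum_card_window_le {y z M : ℝ} (hy : 1 ≤ y) (hz : 1 < z) (hM : 4 * y ^ 2 + 1 ≤ M)
    {A B : Finset ℕ} (hA : ∀ n ∈ A, n.Prime ∧ z < n ∧ (n : ℝ) ≤ y)
    (hB : ∀ m ∈ B, m.Prime ∧ z < m ∧ (m : ℝ) ≤ y)
    (hbig : ∀ m ∈ B, ∀ n ∈ A, 6 * y < (m : ℝ) * n) :
    ∑ m ∈ B, ∑ n ∈ A,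
        ((((Finset.Ioc ⌊y⌋₊ ⌊2 * y⌋₊).filter fun k : ℕ => m * n ∣ k ^ 2 + 1).card : ℕ) : ℝ) ≤
      (Real.log M / Real.log z) ^ 2 *
        (((Finset.Icc 1 ⌊2 * y⌋₊).filter fun k : ℕ =>
            ∀ p : ℕ, p.Prime → p ∣ k ^ 2 + 1 → p ≤ k).card : ℝ) := by
  rw [sum_sum_card_filter_dvd_eq A B]
  set I := Finset.Ioc ⌊y⌋₊ ⌊2 * y⌋₊ with hI
  set L := (Real.log M / Real.log z) ^ 2 with hL
  have hL0 : 0 ≤ L := sq_nonneg _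
  have hy0 : 0 ≤ y := by linarith
  have hpt : ∀ k ∈ I,
      (((B ×ˢ A).filter fun q : ℕ × ℕ => q.1 * q.2 ∣ k ^ 2 + 1).card : ℝ) ≤
        if (∀ p : ℕ, p.Prime → p ∣ k ^ 2 + 1 → p ≤ k) then L else 0 := by
    intro k hk
    rw [hI, Finset.mem_Ioc] at hk
    have hk2y : (k : ℝ) ≤ 2 * y := by
      have : (k : ℝ) ≤ ⌊2 * y⌋₊ := by exact_mod_cast hk.2
      exact this.trans (Nat.floor_le (by linarith))
    rcases Finset.eq_empty_or_nonempty
        ((B ×ˢ A).filter fun q : ℕ × ℕ => q.1 * q.2 ∣ k ^ 2 + 1) with h0 | hne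
    · rw [h0, Finset.card_empty, Nat.cast_zero]
      split_ifs <;> linarith
    · obtain ⟨q, hq⟩ := hne
      rw [Finset.mem_filter, Finset.mem_product] at hq
      obtain ⟨⟨hqB, hqA⟩, hqdvd⟩ := hq
      obtain ⟨hmP, hzm, hmy⟩ := hB _ hqB
      obtain ⟨hnP, hzn, hny⟩ := hA _ hqA
      have hmk : q.1 ≤ k := (Nat.le_floor hmy).trans hk.1.le
      have hnk : q.2 ≤ k := (Nat.le_floor hny).trans hk.1.le
      have hbig' : 3 * k < q.1 * q.2 := by
        have h := hbig _ hqB _ hqA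
        have : (3 * k : ℝ) < (q.1 : ℝ) * q.2 := by linarith
        exact_mod_cast this
      have hsmooth := forall_prime_dvd_le_of_pair_dvd (by omega) hmP hnP hqdvd hmk hnk hbig'
      rw [if_pos hsmooth]
      refine card_pairs_dvd_le hz ?_ (fun n hn => ⟨(hA n hn).1, (hA n hn).2.1⟩)
        (fun m hm => ⟨(hB m hm).1, (hB m hm).2.1⟩)
      push_cast
      nlinarith
  have hIsub : I ⊆ Finset.Icc 1 ⌊2 * y⌋₊ := by
    intro k hk
    rw [hI, Finset.mem_Ioc] at hk
    rw [Finset.mem_Icc]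
    omega
  calc ∑ k ∈ I, (((B ×ˢ A).filter fun q : ℕ × ℕ => q.1 * q.2 ∣ k ^ 2 + 1).card : ℝ)
      ≤ ∑ k ∈ I, (if (∀ p : ℕ, p.Prime → p ∣ k ^ 2 + 1 → p ≤ k) then L else 0) :=
        Finset.sum_le_sum hpt
    _ = L * ((I.filter fun k : ℕ => ∀ p : ℕ, p.Prime → p ∣ k ^ 2 + 1 → p ≤ k).card : ℝ) := by
        rw [Finset.sum_ite, Finset.sum_const_zero, add_zero, Finset.sum_const, nsmul_eq_mul,
          mul_comm]
    _ ≤ L * (((Finset.Icc 1 ⌊2 * y⌋₊).filter fun k : ℕ =>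
            ∀ p : ℕ, p.Prime → p ∣ k ^ 2 + 1 → p ≤ k).card : ℝ) := by
        gcongr


/-! ### Step 5. Assembly: positive lower density of `n`-smooth values of `n² + 1` -/

/-- **`n² + 1` is `n`-smooth for a positive proportion of `n` (Teräväinen 2024, Prop. 2.11 for
`P = X² + 1` in the trivial progression; the exponent-`1` case of Dartyge 1996 / Harman 2008).**
There are `c > 0` and `X₀` such that for all `X ≥ X₀` at least `cX` integers `1 ≤ n ≤ X` have every
prime factor of `n² + 1` at most `n`.  PROVED here from Iwaniec's level of distribution `x^{16/15}`
for `n² + 1` (`Iwaniec1978.proposition1_corollary_holds`) and Mertens' theorem for `ρ`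
(`Iwaniec1978.RhoMertensStrong_holds`): primes `p₁ ∈ (y^{1/32}, y^{1/20}]`,
`p₂ ∈ (6y^{31/32}, y^{39/40}]` with `p₁p₂ ∣ n² + 1`, `y < n ≤ 2y`, force `n² + 1` to be `n`-smooth,
the number of such incidences is `≥ y(∑ρ(p₁)/p₁)(∑ρ(p₂)/p₂) − O(y^{199/200}) ≫ y`, and each `n`
carries at most `96²` of them.  (The paper deduces the general quadratic case from Harman's
half-dimensional sieve; this argument is a different, self-contained route for `X² + 1`.)
[cite: Teravainen2024, Proposition 2.11 (P = X² + 1, q = b = 1)] -/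
theorem sq_add_one_smooth_pos_density :
    ∃ c : ℝ, 0 < c ∧ ∃ X₀ : ℕ, ∀ X : ℕ, X₀ ≤ X →
      c * (X : ℝ) ≤ (((Finset.Icc 1 X).filter fun n : ℕ =>
        ∀ p : ℕ, p.Prime → p ∣ n ^ 2 + 1 → p ≤ n).card : ℝ) := by
  obtain ⟨C₁, hC₁0, hC₁⟩ := sum_sum_card_window_ge (ε := 1 / 200) (by norm_num) (by norm_num)
  obtain ⟨C₂, hC₂⟩ := RhoMertensStrong_holds
  -- the largeness conditions on `y = X/2`
  have h1 : ∀ᶠ y : ℝ in atTop, 5 ≤ y := eventually_ge_atTop 5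
  have h2 : ∀ᶠ y : ℝ in atTop, 6 ≤ y ^ (1 / 160 : ℝ) :=
    (tendsto_rpow_atTop (by norm_num)).eventually_ge_atTop 6
  have h3 : ∀ᶠ y : ℝ in atTop, 640 / 3 * C₂ ≤ Real.log y :=
    Real.tendsto_log_atTop.eventually_ge_atTop _
  have h4 : ∀ᶠ y : ℝ in atTop, 320 * (Real.log 6 + 2 * C₂) ≤ Real.log y :=
    Real.tendsto_log_atTop.eventually_ge_atTop _
  have h5 : ∀ᶠ y : ℝ in atTop, 9984 * C₁ ≤ y ^ (1 / 200 : ℝ) :=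
    (tendsto_rpow_atTop (by norm_num)).eventually_ge_atTop _
  have key : ∀ᶠ y : ℝ in atTop, y / 30670848 ≤
      (((Finset.Icc 1 ⌊2 * y⌋₊).filter fun n : ℕ =>
        ∀ p : ℕ, p.Prime → p ∣ n ^ 2 + 1 → p ≤ n).card : ℝ) := by
    filter_upwards [h1, h2, h3, h4, h5] with y hy1 hy2 hy3 hy4 hy5
    have hy0 : 0 < y := by linarith
    have hy1' : 1 < y := by linarith
    set L := Real.log y with hL
    have hL0 : 0 < L := Real.log_pos hy1'
    -- the two ranges of primes
    set A : Finset ℕ := (Nat.primesLE ⌊y ^ (1 / 20 : ℝ)⌋₊).filter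
      (fun p : ℕ => y ^ (1 / 32 : ℝ) < (p : ℝ)) with hA
    set B : Finset ℕ := (Nat.primesLE ⌊y ^ (39 / 40 : ℝ)⌋₊).filter
      (fun p : ℕ => 6 * y ^ (31 / 32 : ℝ) < (p : ℝ)) with hB
    -- elementary facts about the exponents
    have hz1 : 1 < y ^ (1 / 32 : ℝ) := Real.one_lt_rpow hy1' (by norm_num)
    have hz0 : 0 < y ^ (1 / 32 : ℝ) := by linarith
    have h20_15 : y ^ (1 / 20 : ℝ) < y ^ (1 / 15 - 1 / 200 : ℝ) :=
      Real.rpow_lt_rpow_of_exponent_lt hy1' (by norm_num)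
    have h3940 : y ^ (39 / 40 : ℝ) < y ^ (1 - 4 * (1 / 200) : ℝ) :=
      Real.rpow_lt_rpow_of_exponent_lt hy1' (by norm_num)
    have h20_31 : y ^ (1 / 20 : ℝ) ≤ y ^ (31 / 32 : ℝ) :=
      Real.rpow_le_rpow_of_exponent_le hy1'.le (by norm_num)
    have h31_0 : 0 ≤ y ^ (31 / 32 : ℝ) := by positivity
    have h3940_1 : y ^ (39 / 40 : ℝ) ≤ y := by
      conv_rhs => rw [← Real.rpow_one y]
      exact Real.rpow_le_rpow_of_exponent_le hy1'.le (by norm_num)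
    have h20_1 : y ^ (1 / 20 : ℝ) ≤ y := by
      conv_rhs => rw [← Real.rpow_one y]
      exact Real.rpow_le_rpow_of_exponent_le hy1'.le (by norm_num)
    have hprod : y ^ (31 / 32 : ℝ) * y ^ (1 / 32 : ℝ) = y := by
      rw [← Real.rpow_add hy0]; norm_num
    have hab : 6 * y ^ (31 / 32 : ℝ) ≤ y ^ (39 / 40 : ℝ) := by
      have : y ^ (39 / 40 : ℝ) = y ^ (31 / 32 : ℝ) * y ^ (1 / 160 : ℝ) := by
        rw [← Real.rpow_add hy0]; norm_num
      rw [this]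
      nlinarith
    -- membership consequences
    have hmemA : ∀ n ∈ A, n.Prime ∧ y ^ (1 / 32 : ℝ) < n ∧ (n : ℝ) ≤ y ^ (1 / 20 : ℝ) := by
      intro n hn
      rw [hA, Finset.mem_filter, Nat.mem_primesLE] at hn
      refine ⟨hn.1.2, hn.2, ?_⟩
      have : (n : ℝ) ≤ ⌊y ^ (1 / 20 : ℝ)⌋₊ := by exact_mod_cast hn.1.1
      exact this.trans (Nat.floor_le (by positivity))
    have hmemB : ∀ m ∈ B, m.Prime ∧ 6 * y ^ (31 / 32 : ℝ) < m ∧ (m : ℝ) ≤ y ^ (39 / 40 : ℝ) := by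
      intro m hm
      rw [hB, Finset.mem_filter, Nat.mem_primesLE] at hm
      refine ⟨hm.1.2, hm.2, ?_⟩
      have : (m : ℝ) ≤ ⌊y ^ (39 / 40 : ℝ)⌋₊ := by exact_mod_cast hm.1.1
      exact this.trans (Nat.floor_le (by positivity))
    have hAhyp : ∀ n ∈ A, n.Prime ∧ (n : ℝ) < y ^ (1 / 15 - 1 / 200 : ℝ) := fun n hn =>
      ⟨(hmemA n hn).1, (hmemA n hn).2.2.trans_lt h20_15⟩
    have hBhyp : ∀ m ∈ B, 1 ≤ m ∧ (m : ℝ) < y ^ (1 - 4 * (1 / 200) : ℝ) := fun m hm =>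
      ⟨(hmemB m hm).1.one_lt.le, (hmemB m hm).2.2.trans_lt h3940⟩
    have hABcop : ∀ n ∈ A, ∀ m ∈ B, n.Coprime m := by
      intro n hn m hm
      rw [Nat.coprime_primes (hmemA n hn).1 (hmemB m hm).1]
      intro hnm
      have h1 := (hmemA n hn).2.2
      have h2 := (hmemB m hm).2.1
      rw [hnm] at h1
      linarith
    -- (i) lower bound from the level of distribution
    have hlow := hC₁ y A B (by linarith) hAhyp hBhyp hABcop
    -- (ii) Mertens on the two ranges
    have hSA : 3 / 16 ≤ ∑ p ∈ A, (rho p : ℝ) / p := by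
      have h := sum_rho_div_range_ge hC₂ hz1.le
        (Real.rpow_le_rpow_of_exponent_le hy1'.le (by norm_num : (1 / 32 : ℝ) ≤ 1 / 20))
        (Real.one_lt_rpow hy1' (by norm_num))
      rw [Real.log_rpow hy0, Real.log_rpow hy0] at h
      refine le_trans ?_ h
      rw [le_div_iff₀ (by positivity)]
      linarith
    have hSB : 1 / 312 ≤ ∑ p ∈ B, (rho p : ℝ) / p := by
      have ha1 : 1 ≤ 6 * y ^ (31 / 32 : ℝ) := by
        have : 1 ≤ y ^ (31 / 32 : ℝ) := Real.one_le_rpow hy1'.le (by norm_num)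
        linarith
      have h := sum_rho_div_range_ge hC₂ ha1 hab (Real.one_lt_rpow hy1' (by norm_num))
      rw [Real.log_rpow hy0, Real.log_mul (by norm_num) (by positivity), Real.log_rpow hy0] at h
      refine le_trans ?_ h
      rw [le_div_iff₀ (by positivity)]
      linarith
    have hSB0 : 0 ≤ ∑ p ∈ B, (rho p : ℝ) / p := by linarith
    have hmain : y / 1664 ≤ y * (∑ p ∈ B, (rho p : ℝ) / p) * (∑ p ∈ A, (rho p : ℝ) / p) := by
      have : y * (1 / 312) * (3 / 16) ≤
          y * (∑ p ∈ B, (rho p : ℝ) / p) * (∑ p ∈ A, (rho p : ℝ) / p) :=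
        mul_le_mul (mul_le_mul_of_nonneg_left hSB hy0.le) hSA (by norm_num) (by positivity)
      linarith
    -- (iii) the error term
    have herr : C₁ * ((2 * y) ^ (1 - 1 / 200 : ℝ) + y ^ (1 - 1 / 200 : ℝ)) ≤ y / 3328 := by
      have hcomb : y ^ (1 / 200 : ℝ) * y ^ (1 - 1 / 200 : ℝ) = y := by
        rw [← Real.rpow_add hy0]; norm_num
      have hye0 : 0 ≤ y ^ (1 - 1 / 200 : ℝ) := by positivity
      have h2y : (2 * y) ^ (1 - 1 / 200 : ℝ) ≤ 2 * y ^ (1 - 1 / 200 : ℝ) := by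
        rw [Real.mul_rpow (by norm_num) hy0.le]
        have : (2 : ℝ) ^ (1 - 1 / 200 : ℝ) ≤ 2 := by
          conv_rhs => rw [← Real.rpow_one 2]
          exact Real.rpow_le_rpow_of_exponent_le (by norm_num) (by norm_num)
        exact mul_le_mul_of_nonneg_right this hye0
      calc C₁ * ((2 * y) ^ (1 - 1 / 200 : ℝ) + y ^ (1 - 1 / 200 : ℝ))
          ≤ C₁ * (3 * y ^ (1 - 1 / 200 : ℝ)) := by
            apply mul_le_mul_of_nonneg_left _ hC₁0; linarith
        _ = 3 * C₁ * y ^ (1 - 1 / 200 : ℝ) := by ring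
        _ ≤ y ^ (1 / 200 : ℝ) / 3328 * y ^ (1 - 1 / 200 : ℝ) := by
            apply mul_le_mul_of_nonneg_right _ hye0; linarith
        _ = y / 3328 := by rw [div_mul_eq_mul_div, hcomb]
    -- (iv) upper bound by the smooth count
    have h1_31 : y ^ (1 / 32 : ℝ) ≤ y ^ (31 / 32 : ℝ) :=
      Real.rpow_le_rpow_of_exponent_le hy1'.le (by norm_num)
    have hA' : ∀ n ∈ A, n.Prime ∧ y ^ (1 / 32 : ℝ) < n ∧ (n : ℝ) ≤ y := fun n hn =>
      ⟨(hmemA n hn).1, (hmemA n hn).2.1, (hmemA n hn).2.2.trans h20_1⟩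
    have hB' : ∀ m ∈ B, m.Prime ∧ y ^ (1 / 32 : ℝ) < m ∧ (m : ℝ) ≤ y := fun m hm =>
      ⟨(hmemB m hm).1, by linarith [(hmemB m hm).2.1], (hmemB m hm).2.2.trans h3940_1⟩
    have hbig : ∀ m ∈ B, ∀ n ∈ A, 6 * y < (m : ℝ) * n := by
      intro m hm n hn
      have h1 := (hmemB m hm).2.1
      have h2 := (hmemA n hn).2.1
      calc 6 * y = (6 * y ^ (31 / 32 : ℝ)) * y ^ (1 / 32 : ℝ) := by rw [mul_assoc, hprod]
        _ < (m : ℝ) * n := mul_lt_mul'' h1 h2 (by positivity) hz0.le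
    have hup := sum_sum_card_window_le hy1'.le hz1 (le_refl (4 * y ^ 2 + 1)) hA' hB' hbig
    have hratio : (Real.log (4 * y ^ 2 + 1) / Real.log (y ^ (1 / 32 : ℝ))) ^ 2 ≤ 9216 := by
      rw [Real.log_rpow hy0]
      have hy3 : 4 * y ^ 2 + 1 ≤ y ^ 3 := by
        have h5 : 5 * y ^ 2 ≤ y * y ^ 2 := mul_le_mul_of_nonneg_right hy1 (sq_nonneg y)
        nlinarith
      have hlog3 : Real.log (y ^ 3) = 3 * L := by
        rw [Real.log_pow]; push_cast; ring
      have hM : Real.log (4 * y ^ 2 + 1) ≤ 3 * L := by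
        rw [← hlog3]
        exact Real.log_le_log (by positivity) hy3
      have hr0 : 0 ≤ Real.log (4 * y ^ 2 + 1) / (1 / 32 * L) :=
        div_nonneg (Real.log_nonneg (by nlinarith)) (by positivity)
      have hr : Real.log (4 * y ^ 2 + 1) / (1 / 32 * L) ≤ 96 := by
        rw [div_le_iff₀ (by positivity)]; linarith
      nlinarith
    -- (v) combine
    have hcard0 : 0 ≤ (((Finset.Icc 1 ⌊2 * y⌋₊).filter fun n : ℕ =>
        ∀ p : ℕ, p.Prime → p ∣ n ^ 2 + 1 → p ≤ n).card : ℝ) := Nat.cast_nonneg _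
    have hrc := mul_le_mul_of_nonneg_right hratio hcard0
    linarith only [hlow, hup, hmain, herr, hrc]
  -- pass to natural `X` with `y = X/2`
  have hT : Tendsto (fun X : ℕ => (X : ℝ) / 2) atTop atTop :=
    tendsto_natCast_atTop_atTop.atTop_div_const (by norm_num)
  obtain ⟨X₀, hX₀⟩ := eventually_atTop.mp (hT.eventually key)
  refine ⟨1 / 61341696, by norm_num, X₀, fun X hX => ?_⟩
  have h := hX₀ X hX
  have hfloor : ⌊2 * ((X : ℝ) / 2)⌋₊ = X := by
    rw [mul_div_cancel₀ _ (two_ne_zero' ℝ), Nat.floor_natCast]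
  rw [hfloor] at h
  linarith


/-- **The form used by the Bateman–Horn/ParityCode route** (`SmoothValuesDensity`, verbatim): a
positive lower density of `1 ≤ n ≤ X` all of whose prime factors of `n² + 1` are `≤ 2X` (weaker
than `≤ n`). [cite: Teravainen2024, Proposition 2.11 (P = X² + 1, q = b = 1)] -/
theorem sq_add_one_smooth_twoX_pos_density :
    ∃ c₀ : ℝ, 0 < c₀ ∧ ∃ X₀ : ℕ, ∀ X : ℕ, X₀ ≤ X → c₀ * (X : ℝ) ≤
      (((Finset.Icc 1 X).filter (fun n : ℕ =>
        ∀ p : ℕ, p.Prime → p ∣ n ^ 2 + 1 → p ≤ 2 * X)).card : ℝ) := by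
  obtain ⟨c, hc, X₀, hX₀⟩ := sq_add_one_smooth_pos_density
  refine ⟨c, hc, X₀, fun X hX => (hX₀ X hX).trans ?_⟩
  exact_mod_cast Finset.card_le_card fun n hn => by
    rw [Finset.mem_filter, Finset.mem_Icc] at hn ⊢
    exact ⟨hn.1, fun p hp hpd => (hn.2 p hp hpd).trans (by omega)⟩

/-- **Teräväinen 2024, Proposition 2.11 for `P = X² + 1` in the trivial progression**, in the
exact inner form of `HasPropertyS (X² + 1)` at `q = b = 1`: there is `η₀ > 0` such that for every
`η < η₀/1`, eventually `η x ≤ #{1 ≤ n ≤ x : n ≡ 1 (mod 1), every prime p ∣ P(n) (in ℤ) has p ≤ n}`.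
(The named fact `teravainen2024_prop_2_11_quadratic` asserts this for every quadratic `P` with
positive leading coefficient and every progression, with `η₀` independent of `q, b`; see the
module docstring for what separates this instance from the general statement.)
[cite: Teravainen2024, Proposition 2.11 (P = X² + 1, q = b = 1)] -/
theorem teravainen2024_prop_2_11_sq_add_one_trivial_progression :
    ∃ η₀ : ℝ, 0 < η₀ ∧ ∀ η : ℝ, η < η₀ / (1 : ℕ) →
      ∃ x₀ : ℕ, ∀ x : ℕ, x₀ ≤ x →
        η * (x : ℝ) ≤ (((Finset.Icc 1 x).filter (fun n : ℕ =>
          n % 1 = 1 % 1 ∧ ∀ p : ℕ, p.Prime →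
            (p : ℤ) ∣ (Polynomial.X ^ 2 + 1 : Polynomial ℤ).eval (n : ℤ) → p ≤ n)).card : ℝ) := by
  obtain ⟨c, hc, X₀, hX₀⟩ := sq_add_one_smooth_pos_density
  refine ⟨c, hc, fun η hη => ⟨X₀, fun x hx => ?_⟩⟩
  have hη' : η ≤ c := by rw [Nat.cast_one, div_one] at hη; exact hη.le
  have hset : ((Finset.Icc 1 x).filter fun n : ℕ =>
      ∀ p : ℕ, p.Prime → p ∣ n ^ 2 + 1 → p ≤ n) =
      (Finset.Icc 1 x).filter (fun n : ℕ => n % 1 = 1 % 1 ∧ ∀ p : ℕ, p.Prime →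
        (p : ℤ) ∣ (Polynomial.X ^ 2 + 1 : Polynomial ℤ).eval (n : ℤ) → p ≤ n) := by
    refine Finset.filter_congr fun n _ => ?_
    simp only [Nat.mod_one, true_and, Polynomial.eval_add, Polynomial.eval_pow,
      Polynomial.eval_X, Polynomial.eval_one]
    refine forall_congr' fun p => forall_congr' fun _ => ?_
    rw [show ((n : ℤ) ^ 2 + 1 : ℤ) = ((n ^ 2 + 1 : ℕ) : ℤ) by push_cast; ring, Int.natCast_dvd_natCast]
  rw [← hset]
  have hx0 : (0 : ℝ) ≤ x := Nat.cast_nonneg x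
  calc η * (x : ℝ) ≤ c * x := mul_le_mul_of_nonneg_right hη' hx0
    _ ≤ _ := hX₀ x hx

end Literature.NumberTheory.Sieve

end
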